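import Summits.NavierStokesRegularity.FluidComputer.RowCircuitTime
import Summits.NavierStokesRegularity.FluidComputer.RowCircuitScale
import HarnessLib

/-!
# Every scale runs the same itinerary, `ΛKⁿ` faster: the transfer theorem along the scale map
# (`pub-fluidc-bp3/R1-DESIGN.md` §11.10 (iv)(a); on top of `RowChain.circuit_transfer_timed`)

HONEST FRAMING (cell `pub-fluidc`, blueprint seat bp3, gen 22): low prior, high value-of-information
experiment on Tao's machine paradigm; NOT a claim that NS blows up.

WHAT. `RowChain.circuit_transfer_scaled n A`: for every scale index `n` and amplitude `A > 0`, the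
isolated scale-`n` window `ẇ = ΛKⁿ·F gK ΛK (w)` started at `A·X0` conserves `A²·∑X0²` and reaches,
at a time `τₙ` with `|τₙ − (19/20)/(A·ΛKⁿ)| ≤ (1/200)/(A·ΛKⁿ)`, a state with `a₂ ≥ (2409/2500)·A`
and `|wₐ| ≤ A·capQ a` — i.e. exactly the certified itinerary of `circuit_transfer_timed`, rescaled
by `ChainField.solution_smul` / `solution_speed` (`w t := A·y(A·ΛKⁿ·t)`). This is the per-scale
statement `I(n)`-with-numbers of the blueprint; the RE-ENTRY of the next pass into row 0's start box
(the induction `I(n) ⇒ I(n+1)` INSIDE one flow) is NOT claimed here — §11.10 records the measured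
gap. [cite: Tao2016AveragedNS, §5.5 Thm 5.3 (5.5)]
-/

noncomputable section

namespace Summit.NavierStokesRegularity.FluidComputer

open Literature.Analysis.FluidPDE.FluidComputer

namespace RowChain

open RowCheck RowCheck.RowData RowRun ChainField

/-- `ΛK = 6369051672525773/2^50 > 0`. [folklore] -/
theorem ΛK_pos : 0 < ΛK := by
  rw [ΛK, ΛQ]; exact_mod_cast (by norm_num : (0 : ℚ) < 6369051672525773 / 1125899906842624)

/-- **The transfer theorem at scale `n`, amplitude `A`**: the same itinerary, `A·ΛKⁿ` faster.
[cite: Tao2016AveragedNS, §5.5 Thm 5.3 (5.5)] -/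
theorem circuit_transfer_scaled (n : ℕ) {A : ℝ} (hA : 0 < A) :
    ∃ w : ℝ → Fin 9 → ℝ, w 0 = A • X0 ∧
      (∀ t, HasDerivAt w (ΛK ^ n • F gK ΛK (w t)) t) ∧
      (∀ t, ∑ a, w t a ^ 2 = A ^ 2 * ∑ a, X0 a ^ 2) ∧
      ∃ τ : ℝ, |τ - 19 / 20 / (A * ΛK ^ n)| ≤ 1 / 200 / (A * ΛK ^ n) ∧
        (2409 : ℝ) / 2500 * A ≤ w τ 4 ∧ ∀ a, |w τ a| ≤ A * (capQ a : ℝ) := by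
  obtain ⟨-, -, y, hy0, hsol, hE, τ, hτ, h4, hcap⟩ := circuit_transfer_timed
  have hL : 0 < A * ΛK ^ n := mul_pos hA (pow_pos ΛK_pos n)
  have hA0 : A ≠ 0 := hA.ne'
  have hΛn : ΛK ^ n ≠ 0 := (pow_pos ΛK_pos n).ne'
  have ht : A * (ΛK ^ n * (τ / (A * ΛK ^ n))) = τ := by field_simp
  refine ⟨fun t => A • y (A * (ΛK ^ n * t)), by simp [hy0], ?_, ?_, τ / (A * ΛK ^ n), ?_, ?_, ?_⟩
  · exact solution_speed (solution_smul hsol A) (ΛK ^ n)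
  · intro t
    simp only [Pi.smul_apply, smul_eq_mul, mul_pow, ← Finset.mul_sum, hE]
  · rw [← sub_div, abs_div, abs_of_pos hL]
    exact div_le_div_of_nonneg_right hτ hL.le
  · simp only [ht, Pi.smul_apply, smul_eq_mul]
    nlinarith
  · intro a
    simp only [ht, Pi.smul_apply, smul_eq_mul, abs_mul, abs_of_pos hA]
    exact mul_le_mul_of_nonneg_left (hcap a) hA.le

end RowChain

end Summit.NavierStokesRegularity.FluidComputer
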